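import Summits.Schanuel.Schanuel.Theorems.RootDecomp1KOddEmpty03

/-!
# RootDecomp1KOddEmpty — lens 1, generation 60, NODE 21 «ODD-PRIME EMPTINESS ON THE K-LINE» (reduction of the whole curve modulo an odd prime ℓ: no affine 𝔽_ℓ-point and no liftable point over Y = ∞ ⇒ no rational point with ℓ-integral abscissa ⇒ every level empty; RULE K-R51 (iii) payable clause; CLAIM L2795, PRICE L2798, K-R52) — continuation (RootDecomp1KOddEmpty04): §6 the x-discriminant of VW l: primitive, ℚ-irreducible for l = 3s by a Rabin certificate mod 3 with the tree's node-20 lemmas (section Disc)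

(lens-1 g60 NODE 21 HOME kernel K = HOME/decomp-schanuel-lens-1/g60/OddEmpty.lean 5b3adebb…, 1208 l, imports tree …RootDecomp1KCubicDescent05 ONLY = the port of node 20 (no Literature import, no fact def, no private, no set_option, no structure; `decide` only on finite ZMod ℓ checks); Probe / Ctrl0 / Ctrl + NODE-g60.md + SHA256SUMS; CLAIM L2795, census LIVENESS-v16 L2796 (key oddempty; of record L2798), crit g10 EX-ANTE PRICE L2798 (ONE THEOREM ×1 for (A) the general engine OddEmptyAt + (B) the W4-shape engine TangentEmptyAt + (C) the infinite K-R51-territory family V j JOINTLY iff CHECKLIST K-g60 (1)–(11); RULE K-R52 pre-announced), writer g31 NOTE 1 L2799 (pre-kernel arithmetic re-verified), NODE L2801 / REQUEST L2802, critic VERDICT L2804 (crit g10): CLEARED — THEOREM ×1 for (A) the general engine OddEmptyAt + (B) the W4-shape engine TangentEmptyAt + (C) the infinite K-R51-territory family V j JOINTLY under RULE K-R51 (iii), CHECKLIST K-g60 (1)–(11) met 11/11, rung 0; LABEL OF RECORD: literature = KNOWN TOOL (local insolubility at a finite place / reduction mod ℓ restricted to S-integral points, Hensel failure at a double point with anisotropic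 tangent cone) · relative to the record = NEW LEVER (first odd-place reading of the curve on the K-line) with NEW REACH (first K-R51-territory pairs — no ℚ-rational descent datum — decided hypothesis-free, at the currency LevelFinite / every level EMPTY); RULE K-R52 FIXED verbatim as pre-announced L2798 (toolkit ∪= LOCAL SIEVING IN GENERAL — every further OddEmptyAt / TangentEmptyAt member, ℓ, cone, jet, residue-class or Brauer–Manin-type variant ×0-as-record; OPEN TERRITORY at m₀ = 2 := K-R51 territory ∧ LOCALLY LIVE (census key locsol); standing witness W4 with its smooth ℤ[1/2]-point (0, −2)); TALLY lens-1 ×18 + THEOREM ×20; PORT GO exactly as census STAGING NOTES 11/11b L2800/L2803. Port by census-1 gen 23 as `RootDecomp1KOddEmpty01–05` (`--supports stmt-Schanuel-33364`; no census credit): 01 = §0 helpers, §1 the tree's binary forms `hf` at a prime dividing den r, §2 the equation of a rational point in integers for every `xPolyP k c` and the level abscissa (`not_dvd_den_level`), §3 THE GENERAL ENGINE `OddEmptyAt ℓ P` ⇒ `ratPoint_free_of_oddEmptyAt` / `no_level_of_oddEmptyAt` / `levelFinite_of_oddEmptyAt` / `bddLevelEmpty_of_oddEmptyAt` / `thinFibreAt_of_oddEmptyAt`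 (every m₀); 02 = §4 THE W4-SHAPE ENGINE (`descent_step`, `tangent_descent` — the v_ℓ-descent at the double point (0, ∞) with anisotropic tangent form —, `TangentEmptyAt ℓ P` ⇒ `no_level_of_tangentEmptyAt` / `levelFinite_…` / `bddLevelEmpty_…` / `thinFibreAt_of_tangentEmptyAt`) and §4b the REFUSALS (a rational ℓ-integral point / a root at x = 0 / degree conditions / ℓ = 2 kill the hypotheses); 03 = §5 section Families: `VW l` / `V j := VW (−3 + 15j)` with `tangentEmptyAt_five_V`, **`no_level_V`**, **`levelFinite_V`**, `bddLevelEmpty_V`, **`thinFibreAt_V (j m₀)`** HYPOTHESIS-FREE for every m₀, `EAW l` / `EA j` with `oddEmptyAt_three_EA`, `no_level_EA`, `levelFinite_EA`, `thinFibreAt_EA`, the REFUSED members `W4P` (rational point (0, −2)), `VW (−9)`, `R5P`, CJ 0 — typed non-instances; 04 = §6 section Disc: `xDisc (VW l) = vD l` primitive and ℚ-IRREDUCIBLE for l = 3s by a RABIN certificate mod 3 using the TREE's `dvd_X_pow_sub_X_zmod3` / `irreducible_of_coprime_zmod3` / `irreducible_of_irreducible_map3` (node 20); 05 = §7 section Territory: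 `V_territory (j)` (the K-R49 conjunction by tree names ∧ the K-R51 k = 2 certificate `Irreducible ((xDisc (V j)).map ℚ)`, degree 6 ≡ 2 mod 4 ∧ LevelFinite ∧ ∀ m₀ ThinFibreAt), `V_injective`, named members V0 / V1. PORT EDITS: NONE beyond the provenance doc blocks and the continuation headers (no docstring added — K documents every declaration —, no privatisation — the head dry-run showed no dedup code —, no re-pointing, no import change, no set_option; K's `@[simp]` kept); provenance doc blocks + continuation headers = K's own open-lines; statements and proofs VERBATIM. Rung 0 — nothing here proves Schanuel, 33364, 33363, 31077 or ThinFibre 2; everything HYPOTHESIS-FREE.)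
-/

noncomputable section

namespace Summit.Schanuel.Schanuel.Theorems.RootDecomp1KOddEmpty

open Polynomial LiouvilleNumber
open scoped Nat
open Summit.Schanuel.Schanuel.Theorems.RootDecomp1KTwoBaseCell (psNumer partialSum_eq_psNumer_div coprime_psNumer)
open Summit.Schanuel.Schanuel.Theorems.RootDecomp1KDegreeLadder
open Summit.Schanuel.Schanuel.Theorems.RootDecomp1KXLinear
open Summit.Schanuel.Schanuel.Theorems.RootDecomp1KXLinearII
open Summit.Schanuel.Schanuel.Theorems.RootDecomp1KXTop
open Summit.Schanuel.Schanuel.Theorems.RootDecomp1KXAll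
open Summit.Schanuel.Schanuel.Theorems.RootDecomp1KLevelFinite
open Summit.Schanuel.Schanuel.Theorems.RootDecomp1KThueMahler
open Summit.Schanuel.Schanuel.Theorems.RootDecomp1KParamThueMahler
open Summit.Schanuel.Schanuel.Theorems.RootDecomp1KLocalExponent
open Summit.Schanuel.Schanuel.Theorems.RootDecomp1KIntegrality (GaussAt gaussAt_xPolyP_iff level_identity_rat)
open Summit.Schanuel.Schanuel.Theorems.RootDecomp1KSubspaceBranch (SepTopAt)
open Summit.Schanuel.Schanuel.Theorems.RootDecomp1KHeightGrading (BddLevelEmpty bddLevelEmpty_iff_levelFinite)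
open Summit.Schanuel.Schanuel.Theorems.RootDecomp1KRunge
open Summit.Schanuel.Schanuel.Theorems.RootDecomp1KDescent
open Summit.Schanuel.Schanuel.Theorems.RootDecomp1KCubicDescent

/-! ### §6 The `x`-DISCRIMINANT of `VW l` — PRIMITIVE, and ℚ-IRREDUCIBLE for `l = 3s` (RABIN mod 3, tree lemmas) -/

section Disc

/-- [datum] `Δ_x(VW l) = G² − 4·H_l·Q` EXPANDED (generator `gen60.py`; re-proved by `ring`):
`−7Y⁶ − 28Y⁵ − 4l·Y⁴ + 2Y³ + 136Y² + 476Y + (1 + 68l)`. -/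
def vD (l : ℤ) : ℤ[X] :=
  C ((1) + (68) * l) + C ((476)) * X + C ((136)) * X ^ 2 + C ((2)) * X ^ 3 + C ((-4) * l) * X ^ 4 + C ((-28)) * X ^ 5 + C ((-7)) * X ^ 6
/-- `(l : ℤ) : vC l 1 ^ 2 - 4 * vC l 0 * vC l 2 = vD l`. -/
theorem disc_eq_vD (l : ℤ) : vC l 1 ^ 2 - 4 * vC l 0 * vC l 2 = vD l := by
  simp only [vC_two, vC_one, vC_zero, vQ, vG, vH, vD, map_add, map_mul, map_neg, map_ofNat, map_one]
  ring
/-- `(l : ℤ) : xDisc (VW l) = vD l`. -/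
theorem xDisc_VW (l : ℤ) : xDisc (VW l) = vD l := by
  rw [xDisc, xCoeff_VW, xCoeff_VW, xCoeff_VW, disc_eq_vD]
/-- `(j : ℕ) : xDisc (V j) = vD (vLam j)`. -/
theorem xDisc_V (j : ℕ) : xDisc (V j) = vD (vLam j) := xDisc_VW _
/-- `(l : ℤ) : (vD l).natDegree = 6`. -/
theorem natDegree_vD (l : ℤ) : (vD l).natDegree = 6 := by unfold vD; compute_degree!
/-- `(l : ℤ) : (vD l).coeff 6 = -7`. -/
theorem coeff_vD_six (l : ℤ) : (vD l).coeff 6 = -7 := by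
  rw [vD]; simp only [coeff_add, coeff_C_mul_X_pow, coeff_C_mul_X, coeff_C]; norm_num
/-- `(l : ℤ) : (vD l).coeff 3 = 2`. -/
theorem coeff_vD_three (l : ℤ) : (vD l).coeff 3 = 2 := by
  rw [vD]; simp only [coeff_add, coeff_C_mul_X_pow, coeff_C_mul_X, coeff_C]; norm_num
/-- `(l : ℤ) : (vD l).leadingCoeff = -7`. -/
theorem leadingCoeff_vD (l : ℤ) : (vD l).leadingCoeff = -7 := by rw [leadingCoeff, natDegree_vD, coeff_vD_six]
/-- `Δ_l` is PRIMITIVE for every `l` (its content divides `−7 = lc` and `2 = [Y³]`). -/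
theorem isPrimitive_vD (l : ℤ) : (vD l).IsPrimitive := by
  intro r hr
  rw [C_dvd_iff_dvd_coeff] at hr
  have h6 : r ∣ -7 := by have := hr 6; rwa [coeff_vD_six] at this
  have h3 : r ∣ 2 := by have := hr 3; rwa [coeff_vD_three] at this
  exact (show IsCoprime (2 : ℤ) (-7) from ⟨-3, -1, by norm_num⟩).isUnit_of_dvd' h3 h6

/-- [datum] Rabin cofactors (generator `gen60.py`). -/
def vRa2 : ℤ[X] :=
  C ((1)) + C ((1)) * X ^ 2 + C ((1)) * X ^ 3 + C ((1)) * X ^ 4 + C ((1)) * X ^ 5 + C ((1)) * X ^ 7 + C ((1)) * X ^ 8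
/-- `: ℤ[X]`. -/
def vRb2 : ℤ[X] :=
  C ((2)) + C ((2)) * X + C ((2)) * X ^ 2 + C ((1)) * X ^ 3 + C ((2)) * X ^ 4 + C ((1)) * X ^ 5
/-- `(s : ℤ) : ℤ[X]`. -/
def vRe2 (s : ℤ) : ℤ[X] :=
  C ((68) * s) + C ((158)) * X + C ((45) + (68) * s) * X ^ 2 + C ((159) + (68) * s) * X ^ 3 + C ((204) + (64) * s) * X ^ 4 + C ((195) + (68) * s) * X ^ 5 + C ((202) + (-4) * s) * X ^ 6 + C ((37) + (64) * s) * X ^ 7 + C ((148) + (64) * s) * X ^ 8 + C ((193) + (-4) * s) * X ^ 9 + C ((35)) * X ^ 10 + C ((-1) + (-4) * s) * X ^ 11 + C ((-9) + (-4) * s) * X ^ 12 + C ((-11)) * X ^ 13 + C ((-2)) * X ^ 14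
/-- `: ℤ[X]`. -/
def vRa3 : ℤ[X] :=
  C ((1)) + C ((1)) * X + C ((2)) * X ^ 2 + C ((2)) * X ^ 3 + C ((2)) * X ^ 5 + C ((2)) * X ^ 6 + C ((1)) * X ^ 8 + C ((2)) * X ^ 9 + C ((1)) * X ^ 12 + C ((2)) * X ^ 13 + C ((1)) * X ^ 14 + C ((2)) * X ^ 15 + C ((2)) * X ^ 18 + C ((2)) * X ^ 19 + C ((2)) * X ^ 21 + C ((1)) * X ^ 22 + C ((1)) * X ^ 23 + C ((2)) * X ^ 25 + C ((2)) * X ^ 26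
/-- `: ℤ[X]`. -/
def vRb3 : ℤ[X] :=
  C ((2)) * X + C ((2)) * X ^ 3 + C ((1)) * X ^ 4 + C ((2)) * X ^ 5
/-- `(s : ℤ) : ℤ[X]`. -/
def vRe3 (s : ℤ) : ℤ[X] :=
  C ((68) * s) + C ((159) + (68) * s) * X + C ((204) + (136) * s) * X ^ 2 + C ((364) + (136) * s) * X ^ 3 + C ((408) + (-4) * s) * X ^ 4 + C ((83) + (132) * s) * X ^ 5 + C ((307) + (128) * s) * X ^ 6 + C ((387) + (-8) * s) * X ^ 7 + C ((69) + (68) * s) * X ^ 8 + C ((156) + (128) * s) * X ^ 9 + C ((344) + (-8) * s) * X ^ 10 + C ((68)) * X ^ 11 + C ((-3) + (64) * s) * X ^ 12 + C ((150) + (128) * s) * X ^ 13 + C ((342) + (68) * s) * X ^ 14 + C ((246) + (136) * s) * X ^ 15 + C ((364) + (-4) * s) * X ^ 16 + C ((82) + (-8) * s) * X ^ 17 + C ((-19) + (132) * s) * X ^ 18 + C ((304) + (128) * s) * X ^ 19 + C ((387)) * X ^ 20 + C ((88) + (136) * s) * X ^ 21 + C ((319) + (60) * s) * X ^ 22 +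 C ((231) + (60) * s) * X ^ 23 + C ((182)) * X ^ 24 + C ((42) + (128) * s) * X ^ 25 + C ((300) + (132) * s) * X ^ 26 + C ((394) + (-4) * s) * X ^ 27 + C ((81)) * X ^ 28 + C ((-1) + (-8) * s) * X ^ 29 + C ((-18) + (-8) * s) * X ^ 30 + C ((-23)) * X ^ 31 + C ((-4)) * X ^ 32
/-- RABIN CERTIFICATE 1: `a₂·Δ_{3s} + b₂·(Y⁹ − Y) = 1 + 3·E₂(s)` in `ℤ[Y]`. -/
theorem v_rabin2 (s : ℤ) : vRa2 * vD (3 * s) + vRb2 * (X ^ 9 - X) = 1 + 3 * vRe2 s := by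
  simp only [vRa2, vRb2, vRe2, vD, map_add, map_mul, map_neg, map_ofNat, map_one, one_mul]
  ring
/-- RABIN CERTIFICATE 2: `a₃·Δ_{3s} + b₃·(Y²⁷ − Y) = 1 + 3·E₃(s)` in `ℤ[Y]`. -/
theorem v_rabin3 (s : ℤ) : vRa3 * vD (3 * s) + vRb3 * (X ^ 27 - X) = 1 + 3 * vRe3 s := by
  simp only [vRa3, vRb3, vRe3, vD, map_add, map_mul, map_neg, map_ofNat, map_one, one_mul]
  ring
/-- `Δ_{3s} mod 3 = 2Y⁶ + 2Y⁵ + 2Y³ + Y² + 2Y + 1` is coprime to `Y⁹ − Y` … -/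
theorem isCoprime_vD_map3_nine (s : ℤ) :
    IsCoprime ((vD (3 * s)).map (Int.castRingHom (ZMod 3))) (X ^ 9 - X) := by
  have h := congrArg (Polynomial.map (Int.castRingHom (ZMod 3))) (v_rabin2 s)
  simp only [Polynomial.map_add, Polynomial.map_mul, Polynomial.map_sub, Polynomial.map_pow, Polynomial.map_X,
    Polynomial.map_one, Polynomial.map_ofNat, three_eq_zero_zmod3X, zero_mul, add_zero] at h
  exact ⟨_, _, h⟩
/-- … and to `Y²⁷ − Y`. -/
theorem isCoprime_vD_map3_twentyseven (s : ℤ) :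
    IsCoprime ((vD (3 * s)).map (Int.castRingHom (ZMod 3))) (X ^ 27 - X) := by
  have h := congrArg (Polynomial.map (Int.castRingHom (ZMod 3))) (v_rabin3 s)
  simp only [Polynomial.map_add, Polynomial.map_mul, Polynomial.map_sub, Polynomial.map_pow, Polynomial.map_X,
    Polynomial.map_one, Polynomial.map_ofNat, three_eq_zero_zmod3X, zero_mul, add_zero] at h
  exact ⟨_, _, h⟩
/-- `Δ mod 3` has degree 6 (`−7 ≢ 0`). -/
theorem natDegree_vD_map3 (l : ℤ) : ((vD l).map (Int.castRingHom (ZMod 3))).natDegree = (vD l).natDegree := by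
  refine natDegree_map_of_leadingCoeff_ne_zero _ ?_
  rw [leadingCoeff_vD]
  decide
/-- **`Δ_x(VW (3s))` is IRREDUCIBLE in `ℤ[Y]`** (tree: `irreducible_of_coprime_zmod3`, `irreducible_of_irreducible_map3`). -/
theorem irreducible_vD (s : ℤ) : Irreducible (vD (3 * s)) :=
  irreducible_of_irreducible_map3 (isPrimitive_vD _) (natDegree_vD_map3 _)
    (irreducible_of_coprime_zmod3 (by rw [natDegree_vD_map3, natDegree_vD])
      (isCoprime_vD_map3_nine s) (isCoprime_vD_map3_twentyseven s))
/-- **… hence IRREDUCIBLE OVER `ℚ`** (Gauss). -/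
theorem irreducible_vD_rat (s : ℤ) : Irreducible ((vD (3 * s)).map (Int.castRingHom ℚ)) :=
  (IsPrimitive.Int.irreducible_iff_irreducible_map_cast (isPrimitive_vD _)).mp (irreducible_vD s)
/-- **THE K-R51 `k = 2` CERTIFICATE, TYPED uniformly in `j`: `Δ_x(V j)` is ℚ-IRREDUCIBLE of degree `6 ≡ 2 (mod 4)`**
(NO ℚ-rational 2-torsion on the Jacobian of `y² = Δ_x`; outside every 2-descent class). -/
theorem irreducible_xDisc_V (j : ℕ) :
    Irreducible ((xDisc (V j)).map (Int.castRingHom ℚ)) ∧ (xDisc (V j)).natDegree = 6 ∧ (xDisc (V j)).natDegree % 4 = 2 := by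
  rw [xDisc_V, vLam_three, natDegree_vD]
  exact ⟨irreducible_vD_rat _, rfl, rfl⟩

end Disc

end Summit.Schanuel.Schanuel.Theorems.RootDecomp1KOddEmpty

end
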